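import Summits.BirchSwinnertonDyer.BirchSwinnertonDyer.Theorems.AlignedTransportAtTwoMainConjectureOfRankZeroBSDAtTwoSmallCarrierRoad
import Summits.BirchSwinnertonDyer.BirchSwinnertonDyer.Theorems.AlignedTransportAtTwoMainConjectureOfRankZeroBSDAtTwoFineRoadRelaxedCoefficientsRatTwo
import Summits.BirchSwinnertonDyer.BirchSwinnertonDyer.Theorems.ByReductionTypeAtTwoAdditivePotMultConjATwoCubicFieldDoor
import Summits.BirchSwinnertonDyer.BirchSwinnertonDyer.Theorems.ByReductionTypeAtTwoAdditivePotMultConjATwoTorsionPointFieldDoor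
import Literature.NumberTheory.EllipticCurves.IwasawaModuleFinitePadicIntProofs
import HarnessLib

/-!
# Route `AlignedTransportAtTwo`, crux C2 `MainConjectureOfRankZeroBSDAtTwo` (stmt-BirchSwinnertonDyer-22298):
# the CUBIC-CARRIER ROAD, KERNEL — `MC₂(W)` and the crux BY NAME from PRINT⁵ + MuIneqʳ + Iwasawa `μ₂`-data of the
# CUBIC `2`-torsion fields `ℚ(x(T)) = ℚ̄^{Stab P}` only (plain `μ₂ = 0` on `Δ_W < 0`; narrow `μ₂`-data on `0 < Δ_W`)

HONEST FRAMING (cell `bsd-f1-sign2`, WIDTH-5 attached prover seat `bsd-line-att-p5` gen 24 on line `birth` of the lead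
`bsd-line-att-p2`; `--supports` stmt-BirchSwinnertonDyer-22298, closes nothing; BSD is NOT proved by any of this; the crux C2,
its verdict «blocked-on `Rank1Residual.GreenbergMuConjectureIrreducible`» and every registered stub are untouched). THEOREMS ONLY —
no definition, no named fact, no `sorry`; every arithmetic input is a DISPLAYED hypothesis. Sequel of `…SmallCarrierRoad` (att-p5
g23: the (b″) engine, carrier `ℚ(P, √−1)` of degree `6`) and of `…SexticCriterionKernelLim` (carrier `ℚ(W[2])` on `Δ_W < 0`).

WHY. Skeleton v9's road (b″) input PFμ⁺ (carrier `ℚ(W[2], √−1)`, degree `12`) was shrunk by att-p5 g23 to PFμ⁶ (carrier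
`ℚ(P, √−1)`, degree `6`); its docstring lists the CUBIC carrier `ℚ(e₁)` (degree `3`, on `Δ_W < 0`) as «certificate-equivalent modulo
CFT print ([Iw73] Thm 2/3, «let k be totally imaginary if ℓ = 2»)», and skeleton v5's displayed cubic Prop `PointFieldMuAtTwo` reached
T only through the downstairs Lim door `LimAtTwo` applied at `L = ℚ(P)` — a field WITH a real place, outside that named fact's kernel
scope (REF1-AUDIT §66). Cell bsd-2adic has since put the whole ascent in the kernel: `cruxlead-19573-w2` GEN 7 proved Iwasawa's
`ℓ = 2` ascent along `K(√m)/K` for `K` with AT MOST ONE real embedding (`classicalMu_of_sq_eq_of_odd_finrank`: unit signatures of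
`ℚ_n`, ramified primes of the layers counted), GEN 8 the Kida-lite ascent `K ↦ K(√−1)` for `K` of odd degree under a NARROW-defect
bound (`classicalMu_sup_adjoin_of_sq_eq_neg_one_of_narrowDefect_le`), and `bsd-2adic-k4-w3` GEN 9/10 the general-model doors
(`AddKatoTwo.conjA_two_of_classicalMu_cubicField_of_Δ_neg_of_isGloballyMinimal`: statement (A) at `(W, 2)` for a GLOBALLY MINIMAL `W`
with `Δ_W < 0` and irreducible `W[2]` from `μ₂ = 0` of the cubic field `ℚ(β)`, `β = x(T)` a root of `4x³ + b₂x² + 2b₄x + b₆`;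
`AddKatoTwo.exists_root_fixedField_stabilizer_eq_adjoin`: `ℚ̄^{Stab P} = ℚ(x(P))`). This file composes them with the (b″) engine:

* §1 (`Δ_W < 0`) **`finite_twoTorsion_fineRelaxed_of_classicalMu_cubicField_of_Δ_neg`** — `W/ℚ` globally minimal, `Δ_W < 0`, no
  rational `2`-torsion abscissa, `β` a root of the `2`-division cubic: `μ₂ = 0` for the cyclotomic `ℤ₂`-extensions of `ℚ(β)` ⟹
  `Sel₀^{rel ∞}(ℚ_∞, W[2^∞])[2]` finite for every cyclotomic `κ` (the k4-w3 door gives the STRICT statement (A) in `∃ γ D` form;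
  Lim–Sujatha's lemma `IwasawaModuleFinitePadicInt.finite_pTorsion_of_fineSelmerDualData_moduleFinite` makes it a finiteness; on
  `Δ_W < 0` relaxed = strict, att-p4 g3 `RelaxedRestrict.fineSelmerInftyRelaxedInf_eq_of_Δ_neg`);
  **`lengthAt_relaxedDual_eq_zero_of_classicalMu_cubicField_of_Δ_neg`** (⟹ `ℓ₍₂₎(Yr.X) = 0` for every relaxed dual datum, att-p5 g4
  `LimRelUpstairs.lengthAt_relaxed_eq_zero_of_finite_pTorsion`).
* §2 (`Δ_W < 0`, per curve) **`mazurMainConjecture_two_of_muIneqRel_of_classicalMu_cubicField_of_Δ_neg`**: PRINT {Kato 17.4 (1)(2)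
  at `2`, Greenberg 4.1, period unit, modularity, GZK} + MuIneqʳ + the cell hypotheses + `μ₂(ℚ(x(T))^{cyc}) = 0` ⟹ `MC₂(W)` — NO Lim
  door, NO `√−1`, carrier of degree `3`.
* §3 (BOTH signs, per curve) **`mazurMainConjecture_two_of_muIneqRel_of_narrowMu_cubicField`**: the same from NARROW `μ₂`-data of the
  cubic field `ℚ(x(T))` — (a) `μ₂ = 0` and (b) `ord₂ h⁺ ≤ ord₂ h + D` along its cyclotomic `ℤ₂`-tower — via Kida-lite
  (`μ₂(ℚ(x(T), √−1)) = 0`) and att-p5 g23's `mazurMainConjecture_two_of_muIneqRel_of_classicalMu_pointField_adjoin`; on `0 < Δ_W`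
  (`ℚ(x(T))` totally real) this is the cubic road, on `Δ_W < 0` §2 needs (a) only.
* §4 (the cell, BY NAME) **`mainConjectureOfRankZeroBSDAtTwo_negDisc_of_muIneqRel_of_cubicFieldMu`** (the `Δ_W < 0` half of the crux
  ⟸ PRINT⁵ + MuIneqʳ + H3M⁻), **`mainConjectureOfRankZeroBSDAtTwo_negDisc_of_muIneqRel_of_pointFieldMu`** (the same with skeleton v5's
  displayed Prop `PointFieldMuAtTwo` VERBATIM as the `μ`-input — its old road `…_of_roadB2ineq` needed `LimAtTwo`), and
  **`mainConjectureOfRankZeroBSDAtTwo_of_muIneqRel_of_cubicFieldMu_of_cubicFieldNarrowMu`**: the crux `MainConjectureOfRankZeroBSDAtTwo`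
  ⟸ PRINT⁵ + MuIneqʳ + H3M⁻ («`μ₂(ℚ(x(T))^{cyc}) = 0` for every seed `W` with `Δ_W < 0` and every root `x(T)`») + H3M⁺ («narrow
  `μ₂`-data of the totally real cubic `ℚ(x(T))` for every seed `W` with `0 < Δ_W`»).

INPUT LEDGER of C2 after this file (road (b″), cubic carrier): PRINT⁵ + MuIneqʳ (Kato's `μ`-inequality at `2` against the relaxed
fine dual; print pending typing) + H3M⁻ + H3M⁺ — Iwasawa `μ₂`-statements about the NON-GALOIS CUBIC fields `ℚ(e₁)` of the seed
cell (layers of degree `3·2ⁿ`, plus the narrow tower on `0 < Δ_W`), instead of PFμ⁶'s sextics (`6·2ⁿ`) or PFμ⁺'s degree-`12` fields.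
OPEN class-wide (Ferrero–Washington covers abelian fields only); nothing is asserted about them; nothing is closed; BSD is not proved.

References: [Iwasawa1973MuInvariants] Thm. 2/3, §4; [Washington1997] §13.1, §13.3 Prop. 13.23; [Kida1982JFields] (μ-part, shape);
[CoatesSujatha2005] §3 (A), Thm. 3.4; [LimSujatha2018] §3 Prop. 3.2; [Lim2017FineSelmer] §3 Thm. 3.5, Lemma 3.2; [Kato2004Asterisque]
Thm. 17.4, Prop. 17.11, §17.13; [GreenbergLNM1716] Conj. 1.11, Thm. 4.1, Lemma 4.6; [SilvermanAEC2009] III.§1, VIII.§1; tree p583329,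
p605654, p736077, p737380 (this route), p728213 / p734295 (bsd-2adic w2 GEN 7/8), k4-w3 GEN 9/10 (`…CubicFieldDoor`, `…TorsionPointFieldDoor`).
-/

set_option linter.dupNamespace false
set_option autoImplicit false

noncomputable section

open scoped Classical NumberField Polynomial IntermediateField

namespace Summit.BirchSwinnertonDyer.BirchSwinnertonDyer.Theorems.AlignedTransportAtTwoCubicCarrierRoad

open CongruenceSubgroup WeierstrassCurve NumberField Field Polynomial IntermediateField
  Literature.NumberTheory.EllipticCurves
  Literature.NumberTheory.EllipticCurves.ModularForms
  Literature.NumberTheory.EllipticCurves.Rank1Residual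
  Literature.NumberTheory.EllipticCurves.Greenberg1999
  Literature.NumberTheory.EllipticCurves.Module
  Literature.NumberTheory.GaloisRepresentations
  Literature.NumberTheory.IwasawaTheory
  Literature.NumberTheory.NumberFields
  Summit.BirchSwinnertonDyer.Rank1Residual
  Summit.BirchSwinnertonDyer.Rank1Residual.X1.MuLambda
  Summit.BirchSwinnertonDyer.Rank1Residual.X5
  Summit.BirchSwinnertonDyer.Rank1Residual.F1Sign2
  Summit.BirchSwinnertonDyer.BirchSwinnertonDyer.Theorems.Rank1ResidualX1Defs
  Summit.BirchSwinnertonDyer.BirchSwinnertonDyer.Theses.AlignedTransportAtTwo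
  Summit.BirchSwinnertonDyer.BirchSwinnertonDyer.Theorems.AlignedTransportAtTwoSmallCarrierRoad
  Summit.BirchSwinnertonDyer.BirchSwinnertonDyer.Theorems.AlignedTransportAtTwoFineRoad

/-! ## §1 `Δ_W < 0`: relaxed fine `2`-torsion finiteness and `ℓ₍₂₎(X₀^{rel∞}) = 0` from `μ₂ = 0` of the cubic field `ℚ(x(T))` -/

section NegDiscCubic

variable (W : WeierstrassCurve ℚ) [W.IsElliptic] [W.IsGloballyMinimal]

/-- **`Δ_W < 0`: `μ₂(ℚ(x(T))^{cyc}) = 0` ⟹ `Sel₀^{rel ∞}(ℚ_∞, W[2^∞])[2]` finite.** `W/ℚ` globally minimal with `Δ_W < 0` and no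
rational `2`-torsion abscissa (so `W[2]` is irreducible), `β ∈ ℚ̄` a root of the `2`-division cubic `4x³ + b₂x² + 2b₄x + b₆`: if every
cyclotomic `ℤ₂`-extension of the cubic field `ℚ(β)` has Iwasawa's classical `μ = 0`, then for every cyclotomic `ℤ₂`-extension `κ` of `ℚ`
the `2`-torsion of the relaxed-at-`∞` fine Selmer group over `ℚ_∞` is finite. The k4-w3 general-model cubic door (STRICT statement (A),
`∃ γ D` form; inside: Iwasawa's `ℓ = 2` ascent along `ℚ(W[2]) = ℚ(β)(e₂ − e₃)`, one real place downstairs, none upstairs) +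
Lim–Sujatha's lemma + relaxed = strict on `Δ_W < 0`. [cite: Iwasawa1973MuInvariants, Thm. 2 and Thm. 3, §4]
[cite: CoatesSujatha2005, §3 statement (A) and Thm. 3.4] [cite: LimSujatha2018, §3 Prop. 3.2] [cite: GreenbergLNM1716, §4 Lemma 4.6] -/
theorem finite_twoTorsion_fineRelaxed_of_classicalMu_cubicField_of_Δ_neg (hΔ : W.Δ < 0)
    (ht : ∀ x : ℚ, ¬ HasRationalTwoTorsionX W x)
    {β : AlgebraicClosure ℚ} (hβ : aeval β W.twoTorsionPolynomial.toPoly = 0)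
    (hμ : ∀ κP : ZpExtension ↥(IntermediateField.adjoin ℚ ({β} : Set (AlgebraicClosure ℚ))) 2,
      κP.IsCyclotomic → ClassicalMuVanishes κP)
    (κ : ZpExtension ℚ 2) (hκ : κ.IsCyclotomic) :
    Set.Finite {s : W.fineSelmerInftyRelaxedInf κ | 2 • s = 0} := by
  haveI : Fact (Nat.Prime 2) := ⟨Nat.prime_two⟩
  obtain ⟨γ, D, hD⟩ := AddKatoTwo.conjA_two_of_classicalMu_cubicField_of_Δ_neg_of_isGloballyMinimal W hΔ
    (AlignedTransportAtTwoSeed.irr_two_of_forall_not_hasRationalTwoTorsionX W ht) hβ hμ κ hκ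
  rw [RelaxedCoefficientsRatTwo.finite_nsmul_eq_zero_iff_of_eq (RelaxedRestrict.fineSelmerInftyRelaxedInf_eq_of_Δ_neg W κ hΔ) 2]
  exact IwasawaModuleFinitePadicInt.finite_pTorsion_of_fineSelmerDualData_moduleFinite W κ D hD

/-- **`Δ_W < 0`: `μ₂(ℚ(x(T))^{cyc}) = 0` ⟹ `ℓ₍₂₎(X₀^{rel∞}(W/ℚ_∞)) = 0`** for every cyclotomic datum `(κ, γ)` and every relaxed-at-`∞`
dual fine Selmer datum `Yr` — skeleton v9's Limʳ conclusion for this `W`, from the CUBIC carrier, no door. [cite: Iwasawa1973MuInvariants, Thm. 2 and Thm. 3]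
[cite: Lim2017FineSelmer, §3 Thm. 3.5 and Lemma 3.2] [cite: GreenbergLNM1716, §4 Lemma 4.6 (PDF p. 106)] -/
theorem lengthAt_relaxedDual_eq_zero_of_classicalMu_cubicField_of_Δ_neg (hΔ : W.Δ < 0)
    (ht : ∀ x : ℚ, ¬ HasRationalTwoTorsionX W x)
    {β : AlgebraicClosure ℚ} (hβ : aeval β W.twoTorsionPolynomial.toPoly = 0)
    (hμ : ∀ κP : ZpExtension ↥(IntermediateField.adjoin ℚ ({β} : Set (AlgebraicClosure ℚ))) 2,
      κP.IsCyclotomic → ClassicalMuVanishes κP)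
    {κ : ZpExtension ℚ 2} {γ : Field.absoluteGaloisGroup ℚ} (hκ : κ.IsCyclotomic) (hγ : κ.IsTopGenerator γ)
    (Yr : W.FineSelmerDualDataRelaxedInf κ γ) :
    lengthAt (IwasawaAlgebra 2) Yr.X ⟨IwasawaAlgebra.augIdealP 2, IwasawaAlgebra.isPrime_augIdealP_holds 2⟩ = 0 :=
  LimRelUpstairs.lengthAt_relaxed_eq_zero_of_finite_pTorsion W κ hγ Yr
    (finite_twoTorsion_fineRelaxed_of_classicalMu_cubicField_of_Δ_neg W hΔ ht hβ hμ κ hκ)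

end NegDiscCubic

/-! ## §2 `Δ_W < 0`, per curve: `MC₂(W)` from PRINT⁵ + MuIneqʳ + `μ₂(ℚ(x(T))^{cyc}) = 0` -/

section NegDiscMC

variable (W : WeierstrassCurve ℚ) [W.IsElliptic] [W.IsGloballyMinimal]

/-- **`Δ_W < 0`: the crux's conclusion for `W` from `μ₂ = 0` of the CUBIC field `ℚ(x(T))`, NO Lim door, NO `√−1`.** PRINT {Kato
17.4 (1)(2) at `2` for `W` (`h17`), Greenberg 4.1 (`hGr`), period unit (`hper`), modularity (`hmod`), GZK (`hGZK`)} + MuIneqʳ (`hI`,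
registered stub verbatim) + the cell hypotheses (good ordinary at `2`, no rational `2`-torsion, `Δ_W < 0`, `r_an = 0`, even-branch
`μ(L₂) = 0`, `BSD₂(W)`) + `β` a root of the `2`-division cubic with `μ₂ = 0` along the cyclotomic `ℤ₂`-extensions of `ℚ(β)` ⟹
`MC₂(W)` (p583329's engine through att-p5 g23's (b″) engine and §1). [cite: Kato2004Asterisque, Thm. 17.4 (1)(2) (p. 273)]
[cite: GreenbergLNM1716, Thm. 4.1 (p. 102) and Conj. 1.11 (p. 58)] [cite: Iwasawa1973MuInvariants, Thm. 2 and Thm. 3] -/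
theorem mazurMainConjecture_two_of_muIneqRel_of_classicalMu_cubicField_of_Δ_neg
    (h17 : ∀ [NeZero (W.conductorNorm ℤ)] (f : CuspForm (Gamma0 (W.conductorNorm ℤ)) 2),
      kato_divisibility_allPrimes W 2 (f := f))
    (hGr : Greenberg1999.thm41_charValue_rankZero_anyPrime)
    (hper : realPeriodRat_eq_unit_mul_plusPeriod_two) (hmod : nonempty_modularParametrizationData)
    (hGZK : rank_eq_analyticRank_of_analyticRank_le_one)
    (hI : ∀ (W : WeierstrassCurve ℚ) [W.IsElliptic] [W.IsGloballyMinimal], IsOrdinaryAt W 2 →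
      (∀ x : ℚ, ¬ HasRationalTwoTorsionX W x) →
      ∀ (κ : ZpExtension ℚ 2) (γ : Field.absoluteGaloisGroup ℚ), κ.IsCyclotomic →
      κ.IsTopGenerator γ → IsCyclotomicVariable 2 γ →
      ∀ ⦃N : ℕ⦄ [NeZero N] (f : CuspForm (Gamma0 N) 2), IsNewformOf W f →
      ∀ Gp : IwasawaAlgebra 2, iwasawaToPowerSeries 2 Gp = padicLFunction f (unitRoot W 2 : ℚ_[2]) →
      ∀ (D : W.SelmerDualData κ γ) (Yr : W.FineSelmerDualDataRelaxedInf κ γ),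
        lengthAt (IwasawaAlgebra 2) D.X ⟨IwasawaAlgebra.augIdealP 2, IwasawaAlgebra.isPrime_augIdealP_holds 2⟩ ≤
          lengthAt (IwasawaAlgebra 2) (IwasawaAlgebra 2 ⧸ Ideal.span {Gp})
              ⟨IwasawaAlgebra.augIdealP 2, IwasawaAlgebra.isPrime_augIdealP_holds 2⟩ +
            lengthAt (IwasawaAlgebra 2) Yr.X ⟨IwasawaAlgebra.augIdealP 2, IwasawaAlgebra.isPrime_augIdealP_holds 2⟩)
    (hord : IsOrdinaryAt W 2) (ht : ∀ x : ℚ, ¬ HasRationalTwoTorsionX W x) (hΔ : W.Δ < 0) (hr : W.analyticRank = 0)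
    (hμan : ∀ ⦃N : ℕ⦄ [NeZero N] (f : CuspForm (Gamma0 N) 2), IsNewformOf W f →
      ∀ G : IwasawaAlgebra 2, IsEvenBranchLiftAtTwo W f G → red G ≠ 0)
    (hbsd : BSDp W 2)
    {β : AlgebraicClosure ℚ} (hβ : aeval β W.twoTorsionPolynomial.toPoly = 0)
    (hμ3 : ∀ κP : ZpExtension ↥(IntermediateField.adjoin ℚ ({β} : Set (AlgebraicClosure ℚ))) 2,
      κP.IsCyclotomic → ClassicalMuVanishes κP) :
    MazurMainConjecture W 2 :=
  AlignedTransportAtTwoSeed.mazurMainConjecture_two_of_bsdp_of_mu_eq_zero W h17 hGr hper hmod hGZK hord ht hr hbsd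
    fun _ _ hκ hγ hγ' D _ =>
      selmerDual_mu_eq_zero_of_muIneqRel_of_lengthAt_relaxed_eq_zero W hmod hI hord ht hμan hκ hγ hγ'
        (fun Yr => lengthAt_relaxedDual_eq_zero_of_classicalMu_cubicField_of_Δ_neg W hΔ ht hβ hμ3 hκ hγ Yr) D

end NegDiscMC

/-! ## §3 Both signs, per curve: `MC₂(W)` from NARROW `μ₂`-data of the cubic field `ℚ(x(T))` (Kida-lite to `ℚ(x(T), √−1)`) -/

section NarrowMC

variable (W : WeierstrassCurve ℚ) [W.IsElliptic] [W.IsGloballyMinimal]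

omit [W.IsGloballyMinimal] in
/-- **Narrow `μ₂`-data of the cubic field `ℚ(β)` ⟹ `μ₂ = 0` for every cyclotomic `ℤ₂`-extension of `ℚ̄^{Stab P} ⊔ ℚ⟮i⟯` for
SOME `P ∈ W[2] ∖ 0`** (`β` a root of the `2`-division cubic, `W[2]` irreducible so `[ℚ(β) : ℚ] = 3` is odd, `i² = −1`): bsd-2adic w2 GEN 8's
Kida-lite `classicalMu_sup_adjoin_of_sq_eq_neg_one_of_narrowDefect_le` on `ℚ(β)`, re-keyed to the point field through k4-w3's
`AddKatoTwo.exists_geomTorsion_two_ne_zero_fixedField_stabilizer_eq_adjoin`. [cite: Kida1982JFields, main theorem (μ-part; shape only)]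
[cite: Iwasawa1973MuInvariants, Thm. 2 and Thm. 3, §4] [cite: Washington1997, §13.3 Prop. 13.23] -/
theorem exists_classicalMu_pointField_adjoin_of_narrowMu_cubicField (ht : ∀ x : ℚ, ¬ HasRationalTwoTorsionX W x)
    {β : AlgebraicClosure ℚ} (hβ : aeval β W.twoTorsionPolynomial.toPoly = 0) {i : AlgebraicClosure ℚ} (hi : i ^ 2 = -1)
    (hμ3 : ∀ κP : ZpExtension ↥(IntermediateField.adjoin ℚ ({β} : Set (AlgebraicClosure ℚ))) 2,
      κP.IsCyclotomic → ClassicalMuVanishes κP) (Dδ : ℕ)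
    (hδ : ∀ κP : ZpExtension ↥(IntermediateField.adjoin ℚ ({β} : Set (AlgebraicClosure ℚ))) 2, κP.IsCyclotomic → ∀ n : ℕ,
      ∀ [NumberField ↥(κP.layer n)],
      padicValNat 2 (narrowClassNumber ↥(κP.layer n)) ≤ padicValNat 2 (classNumber ↥(κP.layer n)) + Dδ) :
    ∃ P : geomTorsion W 2, P ≠ 0 ∧
      ∀ κF : ZpExtension ↥(IntermediateField.fixedField (MulAction.stabilizer (absoluteGaloisGroup ℚ) P) ⊔
        IntermediateField.adjoin ℚ ({i} : Set (AlgebraicClosure ℚ))) 2, κF.IsCyclotomic → ClassicalMuVanishes κF := by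
  haveI : Fact (Nat.Prime 2) := ⟨Nat.prime_two⟩
  obtain ⟨P, hP, hF⟩ := AddKatoTwo.exists_geomTorsion_two_ne_zero_fixedField_stabilizer_eq_adjoin W hβ
  haveI : FiniteDimensional ℚ ↥(IntermediateField.adjoin ℚ ({β} : Set (AlgebraicClosure ℚ))) :=
    IntermediateField.adjoin.finiteDimensional ((AlgebraicClosure.isAlgebraic ℚ).isAlgebraic β).isIntegral
  have h3 : Module.finrank ℚ ↥(IntermediateField.adjoin ℚ ({β} : Set (AlgebraicClosure ℚ))) = 3 :=
    AddKatoTwo.finrank_adjoin_root_twoTorsionPolynomial_eq_three W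
      (AlignedTransportAtTwoSeed.irr_two_of_forall_not_hasRationalTwoTorsionX W ht) hβ
  have hodd : Odd (Module.finrank ℚ ↥(IntermediateField.adjoin ℚ ({β} : Set (AlgebraicClosure ℚ)))) := by
    rw [h3]; decide
  have hμ6 := classicalMu_sup_adjoin_of_sq_eq_neg_one_of_narrowDefect_le _ hodd hi hμ3 Dδ hδ
  refine ⟨P, hP, ?_⟩
  rw [hF]
  exact hμ6

/-- **BOTH SIGNS of `Δ_W`: the crux's conclusion for `W` from NARROW `μ₂`-data of the CUBIC field `ℚ(x(T))`.** PRINT⁵ (`h17`, `hGr`,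
`hper`, `hmod`, `hGZK`) + MuIneqʳ (`hI`) + the cell hypotheses (good ordinary at `2`, no rational `2`-torsion, `r_an = 0`, even-branch
`μ(L₂) = 0`, `BSD₂(W)`) + `β` a root of the `2`-division cubic such that every cyclotomic `ℤ₂`-extension of `ℚ(β)` has (a) `μ = 0` and
(b) `ord₂ h⁺(ℚ(β)_n) ≤ ord₂ h(ℚ(β)_n) + D` along its layers ⟹ `MC₂(W)`: Kida-lite gives `μ₂(ℚ(β, √−1)) = 0`, i.e. att-p5 g23's PFμ⁶
input for this `W`, then `…SmallCarrierRoad.mazurMainConjecture_two_of_muIneqRel_of_classicalMu_pointField_adjoin`. No sign condition;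
on `0 < Δ_W` the cubic is totally real and (b) is a statement about totally positive units, on `Δ_W < 0` §2 needs (a) alone.
[cite: Kato2004Asterisque, Thm. 17.4 (1)(2) (p. 273)] [cite: GreenbergLNM1716, Thm. 4.1 (p. 102) and Conj. 1.11 (p. 58)]
[cite: Kida1982JFields, main theorem (μ-part; shape only)] [cite: Iwasawa1973MuInvariants, Thm. 2 and Thm. 3, §4] -/
theorem mazurMainConjecture_two_of_muIneqRel_of_narrowMu_cubicField
    (h17 : ∀ [NeZero (W.conductorNorm ℤ)] (f : CuspForm (Gamma0 (W.conductorNorm ℤ)) 2),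
      kato_divisibility_allPrimes W 2 (f := f))
    (hGr : Greenberg1999.thm41_charValue_rankZero_anyPrime)
    (hper : realPeriodRat_eq_unit_mul_plusPeriod_two) (hmod : nonempty_modularParametrizationData)
    (hGZK : rank_eq_analyticRank_of_analyticRank_le_one)
    (hI : ∀ (W : WeierstrassCurve ℚ) [W.IsElliptic] [W.IsGloballyMinimal], IsOrdinaryAt W 2 →
      (∀ x : ℚ, ¬ HasRationalTwoTorsionX W x) →
      ∀ (κ : ZpExtension ℚ 2) (γ : Field.absoluteGaloisGroup ℚ), κ.IsCyclotomic →
      κ.IsTopGenerator γ → IsCyclotomicVariable 2 γ →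
      ∀ ⦃N : ℕ⦄ [NeZero N] (f : CuspForm (Gamma0 N) 2), IsNewformOf W f →
      ∀ Gp : IwasawaAlgebra 2, iwasawaToPowerSeries 2 Gp = padicLFunction f (unitRoot W 2 : ℚ_[2]) →
      ∀ (D : W.SelmerDualData κ γ) (Yr : W.FineSelmerDualDataRelaxedInf κ γ),
        lengthAt (IwasawaAlgebra 2) D.X ⟨IwasawaAlgebra.augIdealP 2, IwasawaAlgebra.isPrime_augIdealP_holds 2⟩ ≤
          lengthAt (IwasawaAlgebra 2) (IwasawaAlgebra 2 ⧸ Ideal.span {Gp})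
              ⟨IwasawaAlgebra.augIdealP 2, IwasawaAlgebra.isPrime_augIdealP_holds 2⟩ +
            lengthAt (IwasawaAlgebra 2) Yr.X ⟨IwasawaAlgebra.augIdealP 2, IwasawaAlgebra.isPrime_augIdealP_holds 2⟩)
    (hord : IsOrdinaryAt W 2) (ht : ∀ x : ℚ, ¬ HasRationalTwoTorsionX W x) (hr : W.analyticRank = 0)
    (hμan : ∀ ⦃N : ℕ⦄ [NeZero N] (f : CuspForm (Gamma0 N) 2), IsNewformOf W f →
      ∀ G : IwasawaAlgebra 2, IsEvenBranchLiftAtTwo W f G → red G ≠ 0)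
    (hbsd : BSDp W 2)
    {β : AlgebraicClosure ℚ} (hβ : aeval β W.twoTorsionPolynomial.toPoly = 0)
    (hμ3 : ∀ κP : ZpExtension ↥(IntermediateField.adjoin ℚ ({β} : Set (AlgebraicClosure ℚ))) 2,
      κP.IsCyclotomic → ClassicalMuVanishes κP) (Dδ : ℕ)
    (hδ : ∀ κP : ZpExtension ↥(IntermediateField.adjoin ℚ ({β} : Set (AlgebraicClosure ℚ))) 2, κP.IsCyclotomic → ∀ n : ℕ,
      ∀ [NumberField ↥(κP.layer n)],
      padicValNat 2 (narrowClassNumber ↥(κP.layer n)) ≤ padicValNat 2 (classNumber ↥(κP.layer n)) + Dδ) :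
    MazurMainConjecture W 2 := by
  obtain ⟨i, hi⟩ : ∃ i : AlgebraicClosure ℚ, i ^ 2 = -1 := IsAlgClosed.exists_pow_nat_eq (-1) (by norm_num)
  obtain ⟨P, hP, hμ6⟩ := exists_classicalMu_pointField_adjoin_of_narrowMu_cubicField W ht hβ hi hμ3 Dδ hδ
  exact mazurMainConjecture_two_of_muIneqRel_of_classicalMu_pointField_adjoin W h17 hGr hper hmod hGZK hI hord ht hr hμan
    hbsd hP hi hμ6

end NarrowMC

/-! ## §4 The cell, BY NAME: the `Δ_W < 0` half of the crux from H3M⁻ / from `PointFieldMuAtTwo`, and the crux from H3M⁻ + H3M⁺ -/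

section Cell

/-- **The `Δ_W < 0` half of C2 BY its body, cubic carrier: PRINT⁵ + MuIneqʳ + H3M⁻ ⟹ «BSD₂(W) ⟹ MC₂(W)» for every seed-cell `W`
with `Δ_W < 0`.** H3M⁻ (`hμ3`) reads: for every seed-cell curve `W` (non-CM, good ordinary at `2`, no rational `2`-torsion, `Δ_W ∉ ℚ²`,
`r_an = 0`, `BSD₂(W)`) with `Δ_W < 0` and every root `β` of its `2`-division cubic, every cyclotomic `ℤ₂`-extension of the complex cubic
field `ℚ(β)` has Iwasawa's `μ = 0`. Compare `…SexticCriterionKernelLim.crux_negDisc_iff_classicalMu_divisionField_two_kernelLim` (carrier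
the sextic `ℚ(W[2]) = ℚ(β)(√Δ)`): `μ₂(ℚ(β)) = 0 ⟹ μ₂(ℚ(W[2])) = 0` is the kernel ascent inside §1. CONDITIONAL; H3M⁻ is an OPEN
instance of Iwasawa's `μ`-conjecture (non-Galois cubics); nothing closed; BSD is not proved.
[cite: Kato2004Asterisque, Thm. 17.4 (p. 273) and §17.13 (pp. 279–280)] [cite: GreenbergLNM1716, Thm. 4.1 (p. 102) and Conj. 1.11 (p. 58)]
[cite: Iwasawa1973MuInvariants, Thm. 2 and Thm. 3, §4] [cite: CoatesSujatha2005, §3 statement (A) and Thm. 3.4] -/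
theorem mainConjectureOfRankZeroBSDAtTwo_negDisc_of_muIneqRel_of_cubicFieldMu
    (h17 : ∀ (V : WeierstrassCurve ℚ) [V.IsElliptic] [V.IsGloballyMinimal] [NeZero (V.conductorNorm ℤ)]
      (f : CuspForm (Gamma0 (V.conductorNorm ℤ)) 2), kato_divisibility_allPrimes V 2 (f := f))
    (hGr : Greenberg1999.thm41_charValue_rankZero_anyPrime)
    (hper : realPeriodRat_eq_unit_mul_plusPeriod_two) (hmod : nonempty_modularParametrizationData)
    (hGZK : rank_eq_analyticRank_of_analyticRank_le_one)
    (hI : ∀ (W : WeierstrassCurve ℚ) [W.IsElliptic] [W.IsGloballyMinimal], IsOrdinaryAt W 2 →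
      (∀ x : ℚ, ¬ HasRationalTwoTorsionX W x) →
      ∀ (κ : ZpExtension ℚ 2) (γ : Field.absoluteGaloisGroup ℚ), κ.IsCyclotomic →
      κ.IsTopGenerator γ → IsCyclotomicVariable 2 γ →
      ∀ ⦃N : ℕ⦄ [NeZero N] (f : CuspForm (Gamma0 N) 2), IsNewformOf W f →
      ∀ Gp : IwasawaAlgebra 2, iwasawaToPowerSeries 2 Gp = padicLFunction f (unitRoot W 2 : ℚ_[2]) →
      ∀ (D : W.SelmerDualData κ γ) (Yr : W.FineSelmerDualDataRelaxedInf κ γ),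
        lengthAt (IwasawaAlgebra 2) D.X ⟨IwasawaAlgebra.augIdealP 2, IwasawaAlgebra.isPrime_augIdealP_holds 2⟩ ≤
          lengthAt (IwasawaAlgebra 2) (IwasawaAlgebra 2 ⧸ Ideal.span {Gp})
              ⟨IwasawaAlgebra.augIdealP 2, IwasawaAlgebra.isPrime_augIdealP_holds 2⟩ +
            lengthAt (IwasawaAlgebra 2) Yr.X ⟨IwasawaAlgebra.augIdealP 2, IwasawaAlgebra.isPrime_augIdealP_holds 2⟩)
    (hμ3 : ∀ (W : WeierstrassCurve ℚ) [W.IsElliptic] [W.IsGloballyMinimal], ¬ W.HasCM →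
      IsOrdinaryAt W 2 → (∀ x : ℚ, ¬ HasRationalTwoTorsionX W x) → ¬ IsSquare W.Δ →
      W.analyticRank = 0 → BSDp W 2 → W.Δ < 0 →
      ∀ β : AlgebraicClosure ℚ, aeval β W.twoTorsionPolynomial.toPoly = 0 →
      ∀ κP : ZpExtension ↥(IntermediateField.adjoin ℚ ({β} : Set (AlgebraicClosure ℚ))) 2,
        κP.IsCyclotomic → ClassicalMuVanishes κP) :
    ∀ (W : WeierstrassCurve ℚ) [W.IsElliptic] [W.IsGloballyMinimal], ¬ W.HasCM →
      IsOrdinaryAt W 2 → (∀ x : ℚ, ¬ HasRationalTwoTorsionX W x) → ¬ IsSquare W.Δ → W.Δ < 0 →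
      W.analyticRank = 0 →
      (∀ ⦃N : ℕ⦄ [NeZero N] (f : CuspForm (Gamma0 N) 2), IsNewformOf W f →
        ∀ G : IwasawaAlgebra 2, IsEvenBranchLiftAtTwo W f G → red G ≠ 0) →
      BSDp W 2 → MazurMainConjecture W 2 := by
  intro W _ _ hcm hord ht hsq hΔ hr hμan hbsd
  obtain ⟨β, hβ⟩ := AddKatoTwo.exists_aeval_twoTorsionPolynomial_eq_zero W
  exact mazurMainConjecture_two_of_muIneqRel_of_classicalMu_cubicField_of_Δ_neg W (fun f => h17 W f) hGr hper hmod hGZK hI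
    hord ht hΔ hr hμan hbsd hβ (hμ3 W hcm hord ht hsq hr hbsd hΔ β hβ)

/-- **The `Δ_W < 0` half of C2 from skeleton v5's displayed Prop `PointFieldMuAtTwo` VERBATIM (`hPF`), PRINT⁵ + MuIneqʳ — NO Lim door.**
The skeleton's old cubic road `MainConjectureOfRankZeroBSDAtTwo_of_roadB2ineq` consumed `PointFieldMuAtTwo` through `LimAtTwo` (Lim 2017
Thm. 3.5 downstairs at `L = ℚ(P)`, a field with a real place — outside that named fact's kernel scope); here the ascent is bsd-2adic's
kernel theorem. `hPF` restricted to `Δ_W < 0` is what is used. CONDITIONAL; nothing closed; BSD is not proved.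
[cite: Kato2004Asterisque, Thm. 17.4 (p. 273) and §17.13 (pp. 279–280)] [cite: GreenbergLNM1716, Thm. 4.1 (p. 102) and Conj. 1.11 (p. 58)]
[cite: Iwasawa1973MuInvariants, Thm. 2 and Thm. 3, §4] [cite: SilvermanAEC2009, III.§1 and VIII.§1] -/
theorem mainConjectureOfRankZeroBSDAtTwo_negDisc_of_muIneqRel_of_pointFieldMu
    (h17 : ∀ (V : WeierstrassCurve ℚ) [V.IsElliptic] [V.IsGloballyMinimal] [NeZero (V.conductorNorm ℤ)]
      (f : CuspForm (Gamma0 (V.conductorNorm ℤ)) 2), kato_divisibility_allPrimes V 2 (f := f))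
    (hGr : Greenberg1999.thm41_charValue_rankZero_anyPrime)
    (hper : realPeriodRat_eq_unit_mul_plusPeriod_two) (hmod : nonempty_modularParametrizationData)
    (hGZK : rank_eq_analyticRank_of_analyticRank_le_one)
    (hI : ∀ (W : WeierstrassCurve ℚ) [W.IsElliptic] [W.IsGloballyMinimal], IsOrdinaryAt W 2 →
      (∀ x : ℚ, ¬ HasRationalTwoTorsionX W x) →
      ∀ (κ : ZpExtension ℚ 2) (γ : Field.absoluteGaloisGroup ℚ), κ.IsCyclotomic →
      κ.IsTopGenerator γ → IsCyclotomicVariable 2 γ →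
      ∀ ⦃N : ℕ⦄ [NeZero N] (f : CuspForm (Gamma0 N) 2), IsNewformOf W f →
      ∀ Gp : IwasawaAlgebra 2, iwasawaToPowerSeries 2 Gp = padicLFunction f (unitRoot W 2 : ℚ_[2]) →
      ∀ (D : W.SelmerDualData κ γ) (Yr : W.FineSelmerDualDataRelaxedInf κ γ),
        lengthAt (IwasawaAlgebra 2) D.X ⟨IwasawaAlgebra.augIdealP 2, IwasawaAlgebra.isPrime_augIdealP_holds 2⟩ ≤
          lengthAt (IwasawaAlgebra 2) (IwasawaAlgebra 2 ⧸ Ideal.span {Gp})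
              ⟨IwasawaAlgebra.augIdealP 2, IwasawaAlgebra.isPrime_augIdealP_holds 2⟩ +
            lengthAt (IwasawaAlgebra 2) Yr.X ⟨IwasawaAlgebra.augIdealP 2, IwasawaAlgebra.isPrime_augIdealP_holds 2⟩)
    (hPF : ∀ (W : WeierstrassCurve ℚ) [W.IsElliptic] [W.IsGloballyMinimal], ¬ W.HasCM →
      IsOrdinaryAt W 2 → (∀ x : ℚ, ¬ HasRationalTwoTorsionX W x) → ¬ IsSquare W.Δ →
      W.analyticRank = 0 → BSDp W 2 →
      ∃ P : geomTorsion W 2, P ≠ 0 ∧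
        ∀ κL : ZpExtension
            (IntermediateField.fixedField (MulAction.stabilizer (Field.absoluteGaloisGroup ℚ) P)) 2,
          κL.IsCyclotomic → ClassicalMuVanishes κL) :
    ∀ (W : WeierstrassCurve ℚ) [W.IsElliptic] [W.IsGloballyMinimal], ¬ W.HasCM →
      IsOrdinaryAt W 2 → (∀ x : ℚ, ¬ HasRationalTwoTorsionX W x) → ¬ IsSquare W.Δ → W.Δ < 0 →
      W.analyticRank = 0 →
      (∀ ⦃N : ℕ⦄ [NeZero N] (f : CuspForm (Gamma0 N) 2), IsNewformOf W f →
        ∀ G : IwasawaAlgebra 2, IsEvenBranchLiftAtTwo W f G → red G ≠ 0) →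
      BSDp W 2 → MazurMainConjecture W 2 := by
  intro W _ _ hcm hord ht hsq hΔ hr hμan hbsd
  obtain ⟨P, hP, hμP⟩ := hPF W hcm hord ht hsq hr hbsd
  obtain ⟨β, hβ, hF⟩ := AddKatoTwo.exists_root_fixedField_stabilizer_eq_adjoin W hP
  rw [hF] at hμP
  exact mazurMainConjecture_two_of_muIneqRel_of_classicalMu_cubicField_of_Δ_neg W (fun f => h17 W f) hGr hper hmod hGZK hI
    hord ht hΔ hr hμan hbsd hβ hμP

/-- **C2 BY NAME on the CUBIC carrier: PRINT {Kato 17.4 (1)(2) at `2`, Greenberg 4.1, period unit, modularity, GZK} + MuIneqʳ + H3M⁻ +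
H3M⁺ ⟹ `MainConjectureOfRankZeroBSDAtTwo`.** H3M⁻ (`hμ3neg`): for every seed-cell `W` with `Δ_W < 0` and every root `β` of its
`2`-division cubic, `μ₂ = 0` along the cyclotomic `ℤ₂`-extensions of the complex cubic `ℚ(β)`. H3M⁺ (`hμ3pos`): for every seed-cell `W`
with `0 < Δ_W` and every root `β`, some bound `D` such that every cyclotomic `ℤ₂`-extension `κP` of the totally real cubic `ℚ(β)` has
`μ = 0` and `ord₂ h⁺(ℚ(β)_n) ≤ ord₂ h(ℚ(β)_n) + D` along its layers (narrow `μ₂`-data). `Δ_W ≠ 0` splits the cell; §2 on `Δ_W < 0`, §3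
on `0 < Δ_W`. INPUT LEDGER: C2 ⟸ PRINT⁵ + MuIneqʳ + `2`-class-group statements about the CUBIC fields `ℚ(e₁)` of the seed cell ONLY.
CONDITIONAL: the item stmt-BirchSwinnertonDyer-22298 stays open — MuIneqʳ is print pending typing, H3M⁻/H3M⁺ are OPEN instances of
Iwasawa's `μ`-conjecture for non-Galois cubic fields; BSD is not proved.
[cite: Kato2004Asterisque, Thm. 17.4 (p. 273) and §17.13 (pp. 279–280)] [cite: GreenbergLNM1716, Thm. 4.1 (p. 102) and Conj. 1.11 (p. 58)]
[cite: Iwasawa1973MuInvariants, Thm. 2 and Thm. 3, §4] [cite: Kida1982JFields, main theorem (μ-part; shape only)]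
[cite: CoatesSujatha2005, §3 statement (A) and Thm. 3.4] -/
theorem mainConjectureOfRankZeroBSDAtTwo_of_muIneqRel_of_cubicFieldMu_of_cubicFieldNarrowMu
    (h17 : ∀ (V : WeierstrassCurve ℚ) [V.IsElliptic] [V.IsGloballyMinimal] [NeZero (V.conductorNorm ℤ)]
      (f : CuspForm (Gamma0 (V.conductorNorm ℤ)) 2), kato_divisibility_allPrimes V 2 (f := f))
    (hGr : Greenberg1999.thm41_charValue_rankZero_anyPrime)
    (hper : realPeriodRat_eq_unit_mul_plusPeriod_two) (hmod : nonempty_modularParametrizationData)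
    (hGZK : rank_eq_analyticRank_of_analyticRank_le_one)
    (hI : ∀ (W : WeierstrassCurve ℚ) [W.IsElliptic] [W.IsGloballyMinimal], IsOrdinaryAt W 2 →
      (∀ x : ℚ, ¬ HasRationalTwoTorsionX W x) →
      ∀ (κ : ZpExtension ℚ 2) (γ : Field.absoluteGaloisGroup ℚ), κ.IsCyclotomic →
      κ.IsTopGenerator γ → IsCyclotomicVariable 2 γ →
      ∀ ⦃N : ℕ⦄ [NeZero N] (f : CuspForm (Gamma0 N) 2), IsNewformOf W f →
      ∀ Gp : IwasawaAlgebra 2, iwasawaToPowerSeries 2 Gp = padicLFunction f (unitRoot W 2 : ℚ_[2]) →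
      ∀ (D : W.SelmerDualData κ γ) (Yr : W.FineSelmerDualDataRelaxedInf κ γ),
        lengthAt (IwasawaAlgebra 2) D.X ⟨IwasawaAlgebra.augIdealP 2, IwasawaAlgebra.isPrime_augIdealP_holds 2⟩ ≤
          lengthAt (IwasawaAlgebra 2) (IwasawaAlgebra 2 ⧸ Ideal.span {Gp})
              ⟨IwasawaAlgebra.augIdealP 2, IwasawaAlgebra.isPrime_augIdealP_holds 2⟩ +
            lengthAt (IwasawaAlgebra 2) Yr.X ⟨IwasawaAlgebra.augIdealP 2, IwasawaAlgebra.isPrime_augIdealP_holds 2⟩)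
    (hμ3neg : ∀ (W : WeierstrassCurve ℚ) [W.IsElliptic] [W.IsGloballyMinimal], ¬ W.HasCM →
      IsOrdinaryAt W 2 → (∀ x : ℚ, ¬ HasRationalTwoTorsionX W x) → ¬ IsSquare W.Δ →
      W.analyticRank = 0 → BSDp W 2 → W.Δ < 0 →
      ∀ β : AlgebraicClosure ℚ, aeval β W.twoTorsionPolynomial.toPoly = 0 →
      ∀ κP : ZpExtension ↥(IntermediateField.adjoin ℚ ({β} : Set (AlgebraicClosure ℚ))) 2,
        κP.IsCyclotomic → ClassicalMuVanishes κP)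
    (hμ3pos : ∀ (W : WeierstrassCurve ℚ) [W.IsElliptic] [W.IsGloballyMinimal], ¬ W.HasCM →
      IsOrdinaryAt W 2 → (∀ x : ℚ, ¬ HasRationalTwoTorsionX W x) → ¬ IsSquare W.Δ →
      W.analyticRank = 0 → BSDp W 2 → 0 < W.Δ →
      ∀ β : AlgebraicClosure ℚ, aeval β W.twoTorsionPolynomial.toPoly = 0 →
      ∃ D : ℕ, ∀ κP : ZpExtension ↥(IntermediateField.adjoin ℚ ({β} : Set (AlgebraicClosure ℚ))) 2, κP.IsCyclotomic →
        ClassicalMuVanishes κP ∧ ∀ n : ℕ, ∀ [NumberField ↥(κP.layer n)],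
          padicValNat 2 (narrowClassNumber ↥(κP.layer n)) ≤ padicValNat 2 (classNumber ↥(κP.layer n)) + D) :
    MainConjectureOfRankZeroBSDAtTwo := by
  intro W _ _ hcm hord ht hsq hr hμan hbsd
  obtain ⟨β, hβ⟩ := AddKatoTwo.exists_aeval_twoTorsionPolynomial_eq_zero W
  rcases lt_or_gt_of_ne W.isUnit_Δ.ne_zero with hΔ | hΔ
  · exact mazurMainConjecture_two_of_muIneqRel_of_classicalMu_cubicField_of_Δ_neg W (fun f => h17 W f) hGr hper hmod hGZK hI
      hord ht hΔ hr hμan hbsd hβ (hμ3neg W hcm hord ht hsq hr hbsd hΔ β hβ)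
  · obtain ⟨D, hD⟩ := hμ3pos W hcm hord ht hsq hr hbsd hΔ β hβ
    exact mazurMainConjecture_two_of_muIneqRel_of_narrowMu_cubicField W (fun f => h17 W f) hGr hper hmod hGZK hI hord ht hr
      hμan hbsd hβ (fun κP hκP => (hD κP hκP).1) D (fun κP hκP n _ => (hD κP hκP).2 n)

end Cell

end Summit.BirchSwinnertonDyer.BirchSwinnertonDyer.Theorems.AlignedTransportAtTwoCubicCarrierRoad

end
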